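import Literature.NumberTheory.LFunctions.XiJensenRows
import HarnessLib

/-!
# `ξ₁⁽ⁿ⁾ > 0` on the non-negative real axis: the real zeros of every `ξ₁⁽ⁿ⁾` are negative

Topic `Literature/NumberTheory/LFunctions`. Everything here is PROVED. With `ξ₁ = xiSq`
(`ξ(s) = ξ₁((s-½)²)`) and `γ = xiTaylorCoeff` (all `γ(n) > 0`, [GORZPNAS2019, §1]; tree
`xiTaylorCoeff_pos_holds`), the row identity `8 ξ₁⁽ⁿ⁾(x) = Σⱼ γ(n+j) xʲ/j!`
(`hasSum_xiTaylorCoeff_shift`, [Farmer2022, §2 eq. (2.2)]) has non-negative terms for real `x ≥ 0`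
and the `j = 0` term is `γ(n) > 0`:

* `re_iteratedDeriv_xiSq_pos_of_nonneg` — `0 < Re ξ₁⁽ⁿ⁾(x)` for real `x ≥ 0`;
* `iteratedDeriv_xiSq_ofReal_ne_zero_of_nonneg` — `ξ₁⁽ⁿ⁾(x) ≠ 0` for real `x ≥ 0`;
* `neg_of_iteratedDeriv_xiSq_ofReal_eq_zero` — every REAL zero of `ξ₁⁽ⁿ⁾` is negative.

(For `n = 0` this is `ξ(σ) > 0` for real `σ`, i.e. `ζ` has no zeros on `(0,1)`, re-derived from the
Taylor data.) Used by the cell rh-jensen log-band lines (stub «right of the axis»: zeros of `ξ₁⁽ⁿ⁾`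
with `Re z ≥ 0`). RH-FREE; nothing here bears on the truth of RH. AI-produced formalisation
(prover-rh-jensen-eng-2-g4-0, 2026-08-26); AI review is weaker than expert review.

## References
* [GORZPNAS2019] M. Griffin, K. Ono, L. Rolen, D. Zagier, PNAS 116 (2019), §1 (`γ(n) > 0`).
* [Farmer2022] D. W. Farmer, Adv. Math. 411 (2022), §2 eq. (2.2).
-/

noncomputable section

open Complex Filter Topology

namespace Literature.NumberTheory.LFunctions

/-- **`Re ξ₁⁽ⁿ⁾(x) > 0` for real `x ≥ 0`** (indeed `8 Re ξ₁⁽ⁿ⁾(x) = Σⱼ γ(n+j)xʲ/j! ≥ γ(n) > 0`).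
[cite: GORZPNAS2019, §1 (γ(n) > 0)] [cite: Farmer2022, §2 eq. (2.2)] -/
theorem re_iteratedDeriv_xiSq_pos_of_nonneg (n : ℕ) {x : ℝ} (hx : 0 ≤ x) :
    0 < (iteratedDeriv n xiSq x).re := by
  have h := (hasSum_xiTaylorCoeff_shift n (x : ℂ))
  -- real parts: `HasSum (fun j => γ(n+j)/j! * x^j) (8 ξ₁⁽ⁿ⁾ x).re`
  have hre : HasSum (fun j : ℕ => xiTaylorCoeff (n + j) / (j.factorial : ℝ) * x ^ j)
      (8 * iteratedDeriv n xiSq x).re := by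
    have h1 := Complex.hasSum_re h
    refine h1.congr_fun fun j => ?_
    have : (xiTaylorCoeff (n + j) : ℂ) / (j.factorial : ℂ) * (x : ℂ) ^ j =
        ((xiTaylorCoeff (n + j) / (j.factorial : ℝ) * x ^ j : ℝ) : ℂ) := by push_cast; ring
    rw [this, Complex.ofReal_re]
  have hnonneg : ∀ j, 0 ≤ xiTaylorCoeff (n + j) / (j.factorial : ℝ) * x ^ j := fun j => by
    have := xiTaylorCoeff_pos_holds (n + j)
    positivity
  have hge : ∑ j ∈ ({0} : Finset ℕ), xiTaylorCoeff (n + j) / (j.factorial : ℝ) * x ^ j ≤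
      (8 * iteratedDeriv n xiSq x).re :=
    sum_le_hasSum _ (fun j _ => hnonneg j) hre
  simp only [Finset.sum_singleton, add_zero, Nat.factorial_zero, Nat.cast_one, div_one, pow_zero,
    mul_one] at hge
  have hγ : 0 < xiTaylorCoeff n := xiTaylorCoeff_pos_holds n
  have h8 : (8 * iteratedDeriv n xiSq x).re = 8 * (iteratedDeriv n xiSq x).re := by
    simp [Complex.mul_re]
  rw [h8] at hge
  linarith

/-- **`ξ₁⁽ⁿ⁾(x) ≠ 0` for real `x ≥ 0`.** [cite: GORZPNAS2019, §1 (γ(n) > 0)] -/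
theorem iteratedDeriv_xiSq_ofReal_ne_zero_of_nonneg (n : ℕ) {x : ℝ} (hx : 0 ≤ x) :
    iteratedDeriv n xiSq x ≠ 0 := fun h => by
  have := re_iteratedDeriv_xiSq_pos_of_nonneg n hx
  rw [h, Complex.zero_re] at this
  exact lt_irrefl _ this

/-- **Every real zero of `ξ₁⁽ⁿ⁾` is negative:** if `ξ₁⁽ⁿ⁾(z) = 0` and `Im z = 0` then `Re z < 0`.
[cite: GORZPNAS2019, §1 (γ(n) > 0)] -/
theorem re_neg_of_iteratedDeriv_xiSq_eq_zero_of_im_eq_zero (n : ℕ) {z : ℂ}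
    (hz : iteratedDeriv n xiSq z = 0) (him : z.im = 0) : z.re < 0 := by
  by_contra hcon
  push Not at hcon
  have hzx : z = ((z.re : ℝ) : ℂ) := Complex.ext (by simp) (by simp [him])
  rw [hzx] at hz
  exact iteratedDeriv_xiSq_ofReal_ne_zero_of_nonneg n hcon hz

/-- Contrapositive packaging: a zero of `ξ₁⁽ⁿ⁾` with `Re z ≥ 0` is NOT real (so, on the closed right
half-plane, «all zeros real» statements about `ξ₁⁽ⁿ⁾` are statements of zero-FREENESS).
[cite: GORZPNAS2019, §1 (γ(n) > 0)] -/
theorem im_ne_zero_of_iteratedDeriv_xiSq_eq_zero_of_re_nonneg (n : ℕ) {z : ℂ}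
    (hz : iteratedDeriv n xiSq z = 0) (hre : 0 ≤ z.re) : z.im ≠ 0 := fun him =>
  absurd (re_neg_of_iteratedDeriv_xiSq_eq_zero_of_im_eq_zero n hz him) (not_lt.2 hre)

end Literature.NumberTheory.LFunctions
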